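import Summits.QuantumFields.YangMills.Theorems.UnitScaleTiltFluctuationComparisonRegPrFibrePositivity

/-!
# Route `UnitScaleTilt` — crux K1bR-pr `FluctuationComparisonRegPr` (stmt-QuantumFields-19201), stub `stub_posOnSmall` / v2
# `stub_fibrePositivity`: THE TOWER LEMMA, and `posOnSmall` ⇐ ONE-STEP SMALL LIFT ∧ ONE-STEP SUBMERSION (support file; stubs stay open)

Fleet lead `ym-ust-19201-p1` (gen 0); sequel of `UnitScaleTiltFluctuationComparisonRegPrFibrePositivity` («Lemma B» ⇐ measure-openness of the
iterated averaging on the event; continuity (C) of one (0.4) step on small fields).  THIS FILE isolates what is genuinely about ONE step of Bałaban's (0.4) averaging with the printed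
`exp[mean log]` on `SU(2)`:
* §4 (any lattice, any group) **THE TOWER LEMMA** `tower_image_open_and_measureOpen`: if every step is, on open subsets of the `δ₁`-small fields,
  (C) continuous, (O) an OPEN MAP, (N) MEASURE-OPEN (`dU_j(O ∩ avg_j⁻¹A) = 0 ⇒ dV_{j+1}(A ∩ avg_j(O)) = 0`, `A` measurable), then for every height
  `k` the image `avg^k(S_k)` of the UV-small history `S_k = {U : Ū^{i} is ϑ(i)-small, i ≤ k}` (`ϑ ≤ δ₁`) is open, `ϑ(k)`-small, and `avg^k` is
  measure-open on `S_k`; with SURJECTIVITY onto the `ϑ(k)`-small fields (the small lift) this is the reverse absolute continuity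
  `dV_k|_{ϑ(k)-small} ≪ (avg^k)_*(dU|_{S_k})` (`restrict_absolutelyContinuous_map_iter_of_surj`).
* §5 ASSEMBLY: `histGood F ℰp θ K n = S_{K−n}` (`ϑ(i) = θ(K−i)`); **`fibrePositivity_histGood_of_oneStep`** — «Lemma B» for Bałaban's UV-small
  histories from (O) ∧ (N) at a radius `δ ≥ θ` inside the half-guard; **`posOnSmall_of_smallLift_of_oneStepSubmersion`** — THE REGISTERED
  SIGNATURE of `stub_posOnSmall` (= v2's `posOnSmall`) VERBATIM from `[∀ L, ∃ κ δ₀, κ√L ≤ 1 ∧ 0 < δ₀ ∧ OneStepSmallLift]` and `[∀ L, ∃ δ₁ > 0,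
  every step of every run of every family of block size L is (O) ∧ (N) on open subsets of the δ₁-small fields]`; and the same from «Lemma B»
  asked only BELOW A RADIUS (`posOnSmall_of_smallLift_of_fibrePositivityBelow`, `fibrePositivityBelow_of_oneStepSubmersion`) — the honest
  weakening of v2's `stub_fibrePositivity`, which asks it at ALL `γ b₀ p₀`, i.e. also across the guard scale where (0.4) is discontinuous.

WHAT REMAINS (located; NOT PRINTED — Bałaban never needs the averaging to map small fields ONTO small fields, nor its fibres to carry mass):
(S-C) the non-linear `OneStepSmallLift`, `κ√L ≤ 1` (linear core certified: LP kit j252909 at `L = 3`, Whitney form `8L⁴/(L²+1)³` for odd `L ≥ 5`);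
(S-B) ONE-STEP SUBMERSION (O) ∧ (N): in the central-bond coordinates of `BlockAveragingEMLHaarAC` §1 (`Ū(c′)` free of `U(β(c))` for `c′ ≠ c`,
`BlockAveragingHaarAC.isLocal_avgFun`; one-variable law `W ↦ exp(Σ_k |I|⁻¹ log(h_k W*))·W` with injective tangent differential,
`T4EMLFibreAC.kD_tangent_injective`) the map `(u, g) ↦ (u, Ū)` is a local analytic diffeomorphism of `SU(2)^{bonds}` on the small fields, whence
(O) (coordinate projections are open) and (N) (Lusin's property (N) of `C¹` maps + Fubini over the non-central variables + `IsOpenPosMeasure`).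
Nothing of Bałaban's is asserted; every declaration is measure theory / topology about the published formula (0.4).
-/

noncomputable section

open MeasureTheory Filter Topology
open Literature.MathematicalPhysics.QuantumFieldTheory.Balaban1983to89
open Literature.MathematicalPhysics.QuantumFieldTheory.Balaban1983to89.T3ContinuumYM3Torus
open Literature.MathematicalPhysics.QuantumFieldTheory.Balaban1983to89.T3LevelShift
open Literature.MathematicalPhysics.QuantumFieldTheory.Balaban1983to89.T3UnitLawDensityEML (ℰp measurableE_ℰp)
open Literature.MathematicalPhysics.QuantumFieldTheory.Balaban1983to89.T3UnitScaleTilt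
open Literature.MathematicalPhysics.QuantumFieldTheory.Balaban1983to89.T3RestrictedUnitDensity
open Literature.MathematicalPhysics.QuantumFieldTheory.Balaban1983to89.T3TiltDescent
open Literature.MathematicalPhysics.QuantumFieldTheory.Balaban1983to89.T3ConstrainedMinimiser
open Literature.MathematicalPhysics.QuantumFieldTheory.Balaban1983to89.T3SmallLiftHistory
open Literature.MathematicalPhysics.QuantumFieldTheory.Balaban1983to89.T3Thresholds
open Literature.MathematicalPhysics.QuantumFieldTheory.Balaban1983to89.Missing
open Literature.MathematicalPhysics.QuantumFieldTheory.Balaban1983to89.T4Continuum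

namespace Summit.QuantumFields.YangMills.Theorems.PosOnSmallReduction

open Summit.QuantumFields.YangMills.Theorems.FibrePositivity

/-! ## §4 The tower: measure-openness and openness of the image of a UV-small history, from ONE-STEP properties -/

section Iteration

variable {P : Params} {G : Type*} [GaugeGroup G] [MeasurableSpace G] [HaarData G] [TopologicalSpace G]
  (av : ∀ j, Averaging P j G) (ϑ : ℕ → ℝ) (δ₁ : ℝ)

/-- **THE TOWER LEMMA.**  Suppose the small-field regions are open, the height profile `ϑ` stays below `δ₁`, and every averaging
step `avg_j` (`j + 1 ≤ m + K`) is, on the `δ₁`-small fields, (C) continuous, (O) open — images of open subsets are open — and (N)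
MEASURE-OPEN — `dU_j(O ∩ avg_j⁻¹A) = 0 ⇒ dV_{j+1}(A ∩ avg_j(O)) = 0` for open `O`.  Then for every height `k ≤ m + K` the image
`avg^k(S_k)` of the UV-small history `S_k = {U : Ū^{i} is ϑ(i)-small, i ≤ k}` is OPEN, lies in the `ϑ(k)`-small fields, and `avg^k` is
MEASURE-OPEN on `S_k`.  (Induction on `k`: `avg^{k+1}(S_{k+1}) = avg_k(avg^k(S_k) ∩ avg_k⁻¹{ϑ(k+1)-small})`.) [cite: Balaban1985UV3, (7) p.257] -/
theorem tower_image_open_and_measureOpen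
    (hopen : ∀ (j : ℕ) (δ : ℝ), IsOpen {U : GaugeField P j G | PlaqSmall δ U})
    (hmeasS : ∀ (j : ℕ) (δ : ℝ), MeasurableSet {U : GaugeField P j G | PlaqSmall δ U})
    (hmeas : ∀ j, Measurable (av j).avg)
    (hϑ : ∀ i, ϑ i ≤ δ₁)
    (hC : ∀ j, j + 1 ≤ P.m + P.K → ContinuousOn (av j).avg {U : GaugeField P j G | PlaqSmall δ₁ U})
    (hO : ∀ j, j + 1 ≤ P.m + P.K → ∀ O : Set (GaugeField P j G), IsOpen O → O ⊆ {U | PlaqSmall δ₁ U} →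
      IsOpen ((av j).avg '' O))
    (hN : ∀ j, j + 1 ≤ P.m + P.K → ∀ O : Set (GaugeField P j G), IsOpen O → O ⊆ {U | PlaqSmall δ₁ U} →
      ∀ A : Set (GaugeField P (j + 1) G), MeasurableSet A → fieldMeasure P j G (O ∩ (av j).avg ⁻¹' A) = 0 →
        fieldMeasure P (j + 1) G (A ∩ (av j).avg '' O) = 0) :
    ∀ k : ℕ, k ≤ P.m + P.K →
      IsOpen (Averaging.iter av k '' {U | ∀ i, i ≤ k → PlaqSmall (ϑ i) (Averaging.iter av i U)}) ∧
      Averaging.iter av k '' {U | ∀ i, i ≤ k → PlaqSmall (ϑ i) (Averaging.iter av i U)} ⊆ {V | PlaqSmall (ϑ k) V} ∧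
      ∀ A : Set (GaugeField P k G), MeasurableSet A →
        fieldMeasure P 0 G ({U | ∀ i, i ≤ k → PlaqSmall (ϑ i) (Averaging.iter av i U)} ∩ Averaging.iter av k ⁻¹' A) = 0 →
          fieldMeasure P k G (A ∩ Averaging.iter av k '' {U | ∀ i, i ≤ k → PlaqSmall (ϑ i) (Averaging.iter av i U)}) = 0
  | 0, _ => by
    have hS : {U : GaugeField P 0 G | ∀ i, i ≤ 0 → PlaqSmall (ϑ i) (Averaging.iter av i U)} = {U | PlaqSmall (ϑ 0) U} := by
      ext U
      simp only [Set.mem_setOf_eq]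
      constructor
      · intro h
        exact h 0 le_rfl
      · intro h i hi
        obtain rfl : i = 0 := Nat.le_zero.mp hi
        exact h
    have hid : Averaging.iter av 0 = (id : GaugeField P 0 G → GaugeField P 0 G) := rfl
    rw [hS, hid, Set.image_id]
    refine ⟨hopen 0 (ϑ 0), subset_rfl, fun A _ hA => ?_⟩
    rw [Set.preimage_id_eq, Set.inter_comm] at hA
    exact hA
  | k + 1, hk => by
    obtain ⟨hIo, hIs, hIN⟩ := tower_image_open_and_measureOpen hopen hmeasS hmeas hϑ hC hO hN k (by omega)
    -- notation-free abbreviations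
    set S : Set (GaugeField P 0 G) := {U | ∀ i, i ≤ k → PlaqSmall (ϑ i) (Averaging.iter av i U)} with hSdef
    set S' : Set (GaugeField P 0 G) := {U | ∀ i, i ≤ k + 1 → PlaqSmall (ϑ i) (Averaging.iter av i U)} with hS'def
    set T : Set (GaugeField P (k + 1) G) := {V | PlaqSmall (ϑ (k + 1)) V} with hTdef
    set f := Averaging.iter av k with hfdef
    set g := (av k).avg with hgdef
    have hcomp : Averaging.iter av (k + 1) = g ∘ f := rfl
    -- the history one level higher is the old history cut by the new small-field condition
    have hS' : S' = S ∩ f ⁻¹' (g ⁻¹' T) := by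
      ext U
      simp only [hS'def, hSdef, hTdef, Set.mem_setOf_eq, Set.mem_inter_iff, Set.mem_preimage]
      constructor
      · intro h
        exact ⟨fun i hi => h i (Nat.le_succ_of_le hi), h (k + 1) le_rfl⟩
      · rintro ⟨h1, h2⟩ i hi
        rcases Nat.lt_or_ge i (k + 1) with hlt | hge
        · exact h1 i (Nat.lt_succ_iff.mp hlt)
        · obtain rfl : i = k + 1 := le_antisymm hi hge
          exact h2
    -- the open set fed to the last step
    have hfS : f '' S ⊆ {V : GaugeField P k G | PlaqSmall δ₁ V} := fun V hV p => (hIs hV p).trans_le (hϑ k)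
    have hOpen : IsOpen (f '' S ∩ g ⁻¹' T) := ((hC k hk).mono hfS).isOpen_inter_preimage hIo (hopen (k + 1) (ϑ (k + 1)))
    have hOsub : f '' S ∩ g ⁻¹' T ⊆ {V : GaugeField P k G | PlaqSmall δ₁ V} := fun V hV => hfS hV.1
    have himage : Averaging.iter av (k + 1) '' S' = g '' (f '' S ∩ g ⁻¹' T) := by
      rw [hcomp, Set.image_comp, hS', Set.image_inter_preimage]
    refine ⟨?_, ?_, fun A hAm hA => ?_⟩
    · rw [himage]
      exact hO k hk _ hOpen hOsub
    · rw [himage, Set.image_inter_preimage]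
      exact Set.inter_subset_right
    · have hpre : S' ∩ Averaging.iter av (k + 1) ⁻¹' A = S ∩ f ⁻¹' (g ⁻¹' (T ∩ A)) := by
        rw [hS', hcomp, Set.preimage_comp, Set.preimage_inter, Set.preimage_inter, Set.inter_assoc]
      rw [hpre] at hA
      have h1 := hIN (g ⁻¹' (T ∩ A)) ((hmeas k) ((hmeasS (k + 1) (ϑ (k + 1))).inter hAm)) hA
      have hset : g ⁻¹' (T ∩ A) ∩ f '' S = (f '' S ∩ g ⁻¹' T) ∩ g ⁻¹' A := by
        rw [Set.preimage_inter, Set.inter_comm, Set.inter_assoc]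
      rw [hset] at h1
      rw [himage]
      exact hN k hk _ hOpen hOsub A hAm h1

omit [TopologicalSpace G] in
/-- **REVERSE ABSOLUTE CONTINUITY FROM MEASURE-OPENNESS AND A SMALL LIFT**: if moreover every `ϑ(k)`-small field of height `k`
IS the `k`-fold average of some history in `S_k` (surjectivity — the small-lift property), then `dV_k|_{ϑ(k)-small} ≪ (avg^k)_*(dU|_{S_k})`.
[cite: Balaban1985UV3, (7) p.257] -/
theorem restrict_absolutelyContinuous_map_iter_of_surj (hmeas : ∀ j, Measurable (av j).avg) {k : ℕ}
    (hMO : ∀ A : Set (GaugeField P k G), MeasurableSet A →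
      fieldMeasure P 0 G ({U | ∀ i, i ≤ k → PlaqSmall (ϑ i) (Averaging.iter av i U)} ∩ Averaging.iter av k ⁻¹' A) = 0 →
        fieldMeasure P k G (A ∩ Averaging.iter av k '' {U | ∀ i, i ≤ k → PlaqSmall (ϑ i) (Averaging.iter av i U)}) = 0)
    (hsurj : {V : GaugeField P k G | PlaqSmall (ϑ k) V} ⊆
      Averaging.iter av k '' {U | ∀ i, i ≤ k → PlaqSmall (ϑ i) (Averaging.iter av i U)}) :
    (fieldMeasure P k G).restrict {V | PlaqSmall (ϑ k) V} ≪
      Measure.map (Averaging.iter av k) ((fieldMeasure P 0 G).restrict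
        {U | ∀ i, i ≤ k → PlaqSmall (ϑ i) (Averaging.iter av i U)}) := by
  have hm : Measurable (Averaging.iter av k) := measurable_iter av hmeas k
  refine Measure.AbsolutelyContinuous.mk fun A hA h0 => ?_
  rw [Measure.map_apply hm hA, Measure.restrict_apply (hm hA), Set.inter_comm] at h0
  have h1 := hMO A hA h0
  rw [Measure.restrict_apply hA]
  exact measure_mono_null (Set.inter_subset_inter_right A hsurj) h1

end Iteration

/-! ## §5 Assembly: «Lemma B» for the UV-small histories, and `stub_posOnSmall` ⇐ SMALL LIFT ∧ ONE-STEP SUBMERSION -/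

section Assembly

open BlockAveraging ExpMeanLog

variable (F : T3Family)

/-- Bałaban's UV-small-history event with `n` free top steps IS the tower lemma's history `S_{K−n}` for the reversed profile
`ϑ(i) = θ(K − i)` (`n ≤ K`). [cite: Balaban1985UV3, (7) p.257] -/
theorem histGood_eq_setOf_forall_le (θ : ℕ → ℝ) {n K : ℕ} (h : n ≤ K) :
    histGood F ℰp θ K n =
      {U | ∀ i, i ≤ K - n → PlaqSmall (θ (K - i))
        (Averaging.iter (fun i => BlockAveraging.blockAvg (P := F.P K) (j := i) ℰp) i U)} := by
  ext U
  simp only [histGood, Set.mem_setOf_eq]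
  constructor
  · intro hU i hi
    exact hU i (by omega)
  · intro hU j hj
    exact hU j (by omega)

/-- **«LEMMA B» FOR THE UV-SMALL HISTORIES, FROM ONE-STEP SUBMERSION PROPERTIES.**  Let `δ ≥ 0` be a radius inside the half-guard
of the printed `exp[mean log]` (`((5L)²/4)·δ ≤ δ₂/2`) such that every averaging step of the `K`-th approximation is, on open subsets of
the `δ`-small fields, (O) an OPEN MAP and (N) MEASURE-OPEN for product Haar measure; let the threshold profile satisfy `θ ≤ δ`.  Then
`FibrePositivity F γ h (histGood F ℰp θ K n)` for every `n ≤ K`, `γ ≥ 0`: the restricted height density of run `K` is positive at a.e.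
datum whose descent fibre meets the UV-small history.  (Continuity (C) of the steps on small fields is PROVED, §3.) [cite: Balaban1985UV3, (2) p.256, (7) p.257 and (41) p.266] -/
theorem fibrePositivity_histGood_of_oneStep {γ : ℝ} (hγ : 0 ≤ γ) (K : ℕ) {δ : ℝ} (hδ : 0 ≤ δ)
    (hδc : ((((F.P K).d + 2) * (F.P K).L : ℕ) : ℝ) ^ 2 / 4 * δ ≤ deltaSU (Fin 2) / 2)
    (hO : ∀ j, j + 1 ≤ F.m + K → ∀ O : Set (GaugeField (F.P K) j (Matrix.specialUnitaryGroup (Fin 2) ℂ)), IsOpen O →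
      O ⊆ {U | PlaqSmall δ U} → IsOpen ((BlockAveraging.blockAvg (P := F.P K) (j := j) ℰp).avg '' O))
    (hN : ∀ j, j + 1 ≤ F.m + K → ∀ O : Set (GaugeField (F.P K) j (Matrix.specialUnitaryGroup (Fin 2) ℂ)), IsOpen O →
      O ⊆ {U | PlaqSmall δ U} → ∀ A : Set (GaugeField (F.P K) (j + 1) (Matrix.specialUnitaryGroup (Fin 2) ℂ)),
        MeasurableSet A → fieldMeasure (F.P K) j (Matrix.specialUnitaryGroup (Fin 2) ℂ)
            (O ∩ (BlockAveraging.blockAvg (P := F.P K) (j := j) ℰp).avg ⁻¹' A) = 0 →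
          fieldMeasure (F.P K) (j + 1) (Matrix.specialUnitaryGroup (Fin 2) ℂ)
            (A ∩ (BlockAveraging.blockAvg (P := F.P K) (j := j) ℰp).avg '' O) = 0)
    (θ : ℕ → ℝ) (hθ : ∀ i, θ i ≤ δ) {n : ℕ} (h : n ≤ K) :
    FibrePositivity F γ h (histGood F ℰp θ K n) := by
  have htower := tower_image_open_and_measureOpen (P := F.P K) (G := Matrix.specialUnitaryGroup (Fin 2) ℂ)
    (fun i => BlockAveraging.blockAvg (P := F.P K) (j := i) ℰp) (fun i => θ (K - i)) δ
    (fun j δ' => isOpen_setOf_plaqSmall δ') (fun j δ' => measurableSet_plaqSmall δ')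
    (fun j => F.avgMeasurable_of_measurableE ℰp measurableE_ℰp K j) (fun i => hθ _)
    (fun j _ => continuousOn_blockAvg_expMeanLogSU (n := Fin 2) hδ hδc) hO hN (K - n) (by show K - n ≤ F.m + K; omega)
  obtain ⟨_, _, hMO⟩ := htower
  rw [← histGood_eq_setOf_forall_le F θ h] at hMO
  exact fibrePositivity_of_measureOpen F γ h (measurableSet_histGood F ℰp measurableE_ℰp θ K n) hγ hMO

/-- **`stub_posOnSmall` ⇐ ONE-STEP SMALL LIFT (gain `κ√L ≤ 1`) ∧ ONE-STEP SUBMERSION** — the registered signature of the stub of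
`stmt-QuantumFields-19201`, VERBATIM, from two LOCAL properties of ONE (0.4) averaging step on small `SU(2)` fields: for every block size
`L`, (lift) a gain `κ` with `κ√L ≤ 1` and a radius `δ₀ > 0` with one-step lifts at all radii `≤ δ₀` (`T3SmallLiftHistory.OneStepSmallLift`;
linearisation certified, WATCH W7), and (submersion) a radius `δ₁ > 0` such that on open subsets of the `δ₁`-small fields every step is an
open map (O) and measure-open (N) — both consequences of the central-bond normal form of (0.4) (`BlockAveragingEMLHaarAC` §1) and the
inverse function theorem; NOT PRINTED.  The tree's reduction `posOnSmall_clause_of_smallLift` supplies the rest; «Lemma B» is §5 above.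
[cite: Balaban1985UV3, (2) p.256, (7) p.257 and (41) p.266] -/
theorem posOnSmall_of_smallLift_of_oneStepSubmersion
    (hlift : ∀ L : ℕ, ∃ κ δ₀ : ℝ, κ * Real.sqrt L ≤ 1 ∧ 0 < δ₀ ∧
      ∀ F : T3Family, F.L = L → OneStepSmallLift F ℰp κ δ₀)
    (hsub : ∀ L : ℕ, ∃ δ₁ : ℝ, 0 < δ₁ ∧ ∀ F : T3Family, F.L = L → ∀ K j : ℕ, j + 1 ≤ F.m + K →
      (∀ O : Set (GaugeField (F.P K) j (Matrix.specialUnitaryGroup (Fin 2) ℂ)), IsOpen O → O ⊆ {U | PlaqSmall δ₁ U} →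
        IsOpen ((BlockAveraging.blockAvg (P := F.P K) (j := j) ℰp).avg '' O)) ∧
      (∀ O : Set (GaugeField (F.P K) j (Matrix.specialUnitaryGroup (Fin 2) ℂ)), IsOpen O → O ⊆ {U | PlaqSmall δ₁ U} →
        ∀ A : Set (GaugeField (F.P K) (j + 1) (Matrix.specialUnitaryGroup (Fin 2) ℂ)), MeasurableSet A →
          fieldMeasure (F.P K) j (Matrix.specialUnitaryGroup (Fin 2) ℂ)
              (O ∩ (BlockAveraging.blockAvg (P := F.P K) (j := j) ℰp).avg ⁻¹' A) = 0 →
            fieldMeasure (F.P K) (j + 1) (Matrix.specialUnitaryGroup (Fin 2) ℂ)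
              (A ∩ (BlockAveraging.blockAvg (P := F.P K) (j := j) ℰp).avg '' O) = 0)) :
    ∀ (L m : ℕ), 0 < m → ∀ (b₀ p₀ : ℝ), 0 < b₀ → 2 < p₀ → ∃ γ₁ : ℝ, 0 < γ₁ ∧
      ∀ (F : T3Family) (γ : ℝ), F.L = L → 0 < γ → γ ≤ γ₁ →
        ∀ K, ∀ᵐ V ∂fieldMeasure (F.P (K / m)) 0 (Matrix.specialUnitaryGroup (Fin 2) ℂ),
          PlaqSmall (θBal F.L γ b₀ p₀ (K / m)) V →
            0 < heightDensity F γ (Nat.div_le_self K m) (histGood F ℰp (θBal F.L γ b₀ p₀) K (K / m)) V ∧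
            0 < heightDensity F γ ((Nat.div_le_self K m).trans (Nat.le_succ K))
                  (histGood F ℰp (θBal F.L γ b₀ p₀) (K + 1) (K / m)) V := by
  intro L m _ b₀ p₀ hb hp
  obtain ⟨κ, δ₀, hκ, hδ₀, hF⟩ := hlift L
  obtain ⟨δ₁, hδ₁, hS⟩ := hsub L
  -- a radius inside the half-guard of the printed `exp[mean log]` at block size `L` (`d = 3`)
  set δc : ℝ := 2 * deltaSU (Fin 2) / ((((3 + 2) * L : ℕ) : ℝ) ^ 2 + 1) with hδc_def
  have hsq : (0 : ℝ) < (((3 + 2) * L : ℕ) : ℝ) ^ 2 + 1 := by positivity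
  have hδc : 0 < δc := div_pos (mul_pos two_pos deltaSU_pos) hsq
  set σ : ℝ := min δ₀ (min δ₁ δc) with hσ_def
  have hσ : 0 < σ := lt_min hδ₀ (lt_min hδ₁ hδc)
  obtain ⟨γ₁, hγ₁, hγ₁1, hθ⟩ := exists_gamma_forall_θBal_le (b₀ := b₀) (p₀ := p₀) hb (by linarith) hσ
  refine ⟨γ₁, hγ₁, fun F γ hFL hγ hγγ₁ K => ?_⟩
  have hL : 1 ≤ F.L := F.hL.2.le
  subst hFL
  have hθσ : ∀ i, θBal F.L γ b₀ p₀ i ≤ σ := fun i => hθ F.L hL γ hγ hγγ₁ i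
  have hθ₀ : ∀ i, θBal F.L γ b₀ p₀ i ≤ δ₀ := fun i => (hθσ i).trans (min_le_left _ _)
  -- the working radius for the submersion properties: `δ := min δ₁ δc`
  have hδ : 0 ≤ min δ₁ δc := (lt_min hδ₁ hδc).le
  have hθδ : ∀ i, θBal F.L γ b₀ p₀ i ≤ min δ₁ δc := fun i => (hθσ i).trans (min_le_right _ _)
  have hguard : ∀ K' : ℕ, ((((F.P K').d + 2) * (F.P K').L : ℕ) : ℝ) ^ 2 / 4 * min δ₁ δc ≤ deltaSU (Fin 2) / 2 := by
    intro K'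
    have e : ((((F.P K').d + 2) * (F.P K').L : ℕ) : ℝ) = (((3 + 2) * F.L : ℕ) : ℝ) := rfl
    rw [e]
    set x : ℝ := (((3 + 2) * F.L : ℕ) : ℝ) ^ 2 with hx
    have hx0 : 0 ≤ x := by positivity
    have h1 : x / 4 * min δ₁ δc ≤ x / 4 * δc := mul_le_mul_of_nonneg_left (min_le_right _ _) (by positivity)
    have h2 : x / 4 * δc = deltaSU (Fin 2) / 2 * (x / (x + 1)) := by
      rw [hδc_def]
      field_simp
      ring
    have h3 : x / (x + 1) ≤ 1 := by
      rw [div_le_one (by positivity)]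
      linarith
    calc x / 4 * min δ₁ δc ≤ x / 4 * δc := h1
      _ = deltaSU (Fin 2) / 2 * (x / (x + 1)) := h2
      _ ≤ deltaSU (Fin 2) / 2 * 1 := mul_le_mul_of_nonneg_left h3 (div_pos deltaSU_pos two_pos).le
      _ = deltaSU (Fin 2) / 2 := mul_one _
  -- (O), (N) at the smaller radius
  have hO : ∀ K' j, j + 1 ≤ F.m + K' → ∀ O : Set (GaugeField (F.P K') j (Matrix.specialUnitaryGroup (Fin 2) ℂ)), IsOpen O →
      O ⊆ {U | PlaqSmall (min δ₁ δc) U} → IsOpen ((BlockAveraging.blockAvg (P := F.P K') (j := j) ℰp).avg '' O) :=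
    fun K' j hj O hOo hOs => (hS F rfl K' j hj).1 O hOo fun U hU p => (hOs hU p).trans_le (min_le_left _ _)
  have hN : ∀ K' j, j + 1 ≤ F.m + K' → ∀ O : Set (GaugeField (F.P K') j (Matrix.specialUnitaryGroup (Fin 2) ℂ)), IsOpen O →
      O ⊆ {U | PlaqSmall (min δ₁ δc) U} → ∀ A : Set (GaugeField (F.P K') (j + 1) (Matrix.specialUnitaryGroup (Fin 2) ℂ)),
        MeasurableSet A → fieldMeasure (F.P K') j (Matrix.specialUnitaryGroup (Fin 2) ℂ)
            (O ∩ (BlockAveraging.blockAvg (P := F.P K') (j := j) ℰp).avg ⁻¹' A) = 0 →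
          fieldMeasure (F.P K') (j + 1) (Matrix.specialUnitaryGroup (Fin 2) ℂ)
            (A ∩ (BlockAveraging.blockAvg (P := F.P K') (j := j) ℰp).avg '' O) = 0 :=
    fun K' j hj O hOo hOs => (hS F rfl K' j hj).2 O hOo fun U hU p => (hOs hU p).trans_le (min_le_left _ _)
  exact posOnSmall_clause_of_smallLift (hF F rfl) hκ hγ (hγγ₁.trans hγ₁1) hb (by linarith) hθ₀ m K
    (fibrePositivity_histGood_of_oneStep F hγ.le K hδ (hguard K) (hO K) (hN K) _ hθδ _)
    (fibrePositivity_histGood_of_oneStep F hγ.le (K + 1) hδ (hguard (K + 1)) (hO (K + 1)) (hN (K + 1)) _ hθδ _)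

/-- **`stub_posOnSmall` ⇐ ONE-STEP SMALL LIFT ∧ FIBRE POSITIVITY BELOW A RADIUS** — the registered signature VERBATIM from the small-lift
schema (as in p428548) and «Lemma B» asked ONLY for threshold profiles below some radius `δ₁(L) > 0` (the regime the crux uses: `γ₁` is shrunk
until every `θBal(i) ≤ min δ₀ δ₁`, `T3Thresholds.exists_gamma_forall_θBal_le`).  This is the honest weakening of the v2 stub `stub_fibrePositivity`
(which asks «Lemma B» at ALL `γ b₀ p₀`, i.e. also across the guard scale of the printed average, where (0.4) is discontinuous); it is
discharged by `fibrePositivity_histGood_of_oneStep` from (O) ∧ (N). [cite: Balaban1985UV3, (7) p.257 and (41) p.266] -/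
theorem posOnSmall_of_smallLift_of_fibrePositivityBelow
    (hlift : ∀ L : ℕ, ∃ κ δ₀ : ℝ, κ * Real.sqrt L ≤ 1 ∧ 0 < δ₀ ∧
      ∀ F : T3Family, F.L = L → OneStepSmallLift F ℰp κ δ₀)
    (hpos : ∀ L : ℕ, ∃ δ₁ : ℝ, 0 < δ₁ ∧ ∀ F : T3Family, F.L = L → ∀ (γ b₀ p₀ : ℝ) (n K : ℕ) (h : n ≤ K),
      0 < γ → (∀ i, θBal F.L γ b₀ p₀ i ≤ δ₁) → FibrePositivity F γ h (histGood F ℰp (θBal F.L γ b₀ p₀) K n)) :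
    ∀ (L m : ℕ), 0 < m → ∀ (b₀ p₀ : ℝ), 0 < b₀ → 2 < p₀ → ∃ γ₁ : ℝ, 0 < γ₁ ∧
      ∀ (F : T3Family) (γ : ℝ), F.L = L → 0 < γ → γ ≤ γ₁ →
        ∀ K, ∀ᵐ V ∂fieldMeasure (F.P (K / m)) 0 (Matrix.specialUnitaryGroup (Fin 2) ℂ),
          PlaqSmall (θBal F.L γ b₀ p₀ (K / m)) V →
            0 < heightDensity F γ (Nat.div_le_self K m) (histGood F ℰp (θBal F.L γ b₀ p₀) K (K / m)) V ∧
            0 < heightDensity F γ ((Nat.div_le_self K m).trans (Nat.le_succ K))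
                  (histGood F ℰp (θBal F.L γ b₀ p₀) (K + 1) (K / m)) V := by
  intro L m _ b₀ p₀ hb hp
  obtain ⟨κ, δ₀, hκ, hδ₀, hF⟩ := hlift L
  obtain ⟨δ₁, hδ₁, hP⟩ := hpos L
  obtain ⟨γ₁, hγ₁, hγ₁1, hθ⟩ := exists_gamma_forall_θBal_le (b₀ := b₀) (p₀ := p₀) hb (by linarith) (lt_min hδ₀ hδ₁)
  refine ⟨γ₁, hγ₁, fun F γ hFL hγ hγγ₁ K => ?_⟩
  have hL : 1 ≤ F.L := F.hL.2.le
  subst hFL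
  have hθ₀ : ∀ i, θBal F.L γ b₀ p₀ i ≤ δ₀ := fun i => (hθ F.L hL γ hγ hγγ₁ i).trans (min_le_left _ _)
  have hθ₁ : ∀ i, θBal F.L γ b₀ p₀ i ≤ δ₁ := fun i => (hθ F.L hL γ hγ hγγ₁ i).trans (min_le_right _ _)
  exact posOnSmall_clause_of_smallLift (hF F rfl) hκ hγ (hγγ₁.trans hγ₁1) hb (by linarith) hθ₀ m K
    (hP F rfl γ b₀ p₀ _ _ _ hγ hθ₁) (hP F rfl γ b₀ p₀ _ _ _ hγ hθ₁)

/-- **FIBRE POSITIVITY BELOW A RADIUS ⇐ ONE-STEP SUBMERSION** (the shape consumed by `posOnSmall_of_smallLift_of_fibrePositivityBelow`):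
(O) ∧ (N) at a radius `δ₁ > 0` for every step of every run of the families of block size `L` give «Lemma B» for every coupling `γ > 0` and
threshold profile `θBal ≤ min δ₁ δc(L)`, `δc(L) = 2δ₂/((5L)²+1)` the half-guard radius. [cite: Balaban1985UV3, (7) p.257 and (41) p.266] -/
theorem fibrePositivityBelow_of_oneStepSubmersion
    (hsub : ∀ L : ℕ, ∃ δ₁ : ℝ, 0 < δ₁ ∧ ∀ F : T3Family, F.L = L → ∀ K j : ℕ, j + 1 ≤ F.m + K →
      (∀ O : Set (GaugeField (F.P K) j (Matrix.specialUnitaryGroup (Fin 2) ℂ)), IsOpen O → O ⊆ {U | PlaqSmall δ₁ U} →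
        IsOpen ((BlockAveraging.blockAvg (P := F.P K) (j := j) ℰp).avg '' O)) ∧
      (∀ O : Set (GaugeField (F.P K) j (Matrix.specialUnitaryGroup (Fin 2) ℂ)), IsOpen O → O ⊆ {U | PlaqSmall δ₁ U} →
        ∀ A : Set (GaugeField (F.P K) (j + 1) (Matrix.specialUnitaryGroup (Fin 2) ℂ)), MeasurableSet A →
          fieldMeasure (F.P K) j (Matrix.specialUnitaryGroup (Fin 2) ℂ)
              (O ∩ (BlockAveraging.blockAvg (P := F.P K) (j := j) ℰp).avg ⁻¹' A) = 0 →
            fieldMeasure (F.P K) (j + 1) (Matrix.specialUnitaryGroup (Fin 2) ℂ)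
              (A ∩ (BlockAveraging.blockAvg (P := F.P K) (j := j) ℰp).avg '' O) = 0)) :
    ∀ L : ℕ, ∃ δ₁ : ℝ, 0 < δ₁ ∧ ∀ F : T3Family, F.L = L → ∀ (γ b₀ p₀ : ℝ) (n K : ℕ) (h : n ≤ K),
      0 < γ → (∀ i, θBal F.L γ b₀ p₀ i ≤ δ₁) → FibrePositivity F γ h (histGood F ℰp (θBal F.L γ b₀ p₀) K n) := by
  intro L
  obtain ⟨δ₁, hδ₁, hS⟩ := hsub L
  set δc : ℝ := 2 * deltaSU (Fin 2) / ((((3 + 2) * L : ℕ) : ℝ) ^ 2 + 1) with hδc_def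
  have hsq : (0 : ℝ) < (((3 + 2) * L : ℕ) : ℝ) ^ 2 + 1 := by positivity
  have hδc : 0 < δc := div_pos (mul_pos two_pos deltaSU_pos) hsq
  refine ⟨min δ₁ δc, lt_min hδ₁ hδc, fun F hFL γ b₀ p₀ n K h hγ hθ => ?_⟩
  subst hFL
  have hδ : 0 ≤ min δ₁ δc := (lt_min hδ₁ hδc).le
  have hguard : ((((F.P K).d + 2) * (F.P K).L : ℕ) : ℝ) ^ 2 / 4 * min δ₁ δc ≤ deltaSU (Fin 2) / 2 := by
    have e : ((((F.P K).d + 2) * (F.P K).L : ℕ) : ℝ) = (((3 + 2) * F.L : ℕ) : ℝ) := rfl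
    rw [e]
    set x : ℝ := (((3 + 2) * F.L : ℕ) : ℝ) ^ 2 with hx
    have hx0 : 0 ≤ x := by positivity
    have h1 : x / 4 * min δ₁ δc ≤ x / 4 * δc := mul_le_mul_of_nonneg_left (min_le_right _ _) (by positivity)
    have h2 : x / 4 * δc = deltaSU (Fin 2) / 2 * (x / (x + 1)) := by
      rw [hδc_def]
      field_simp
      ring
    have h3 : x / (x + 1) ≤ 1 := by
      rw [div_le_one (by positivity)]
      linarith
    calc x / 4 * min δ₁ δc ≤ x / 4 * δc := h1
      _ = deltaSU (Fin 2) / 2 * (x / (x + 1)) := h2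
      _ ≤ deltaSU (Fin 2) / 2 * 1 := mul_le_mul_of_nonneg_left h3 (div_pos deltaSU_pos two_pos).le
      _ = deltaSU (Fin 2) / 2 := mul_one _
  refine fibrePositivity_histGood_of_oneStep F hγ.le K hδ hguard
    (fun j hj O hOo hOs => (hS F rfl K j hj).1 O hOo fun U hU p => (hOs hU p).trans_le (min_le_left _ _))
    (fun j hj O hOo hOs => (hS F rfl K j hj).2 O hOo fun U hU p => (hOs hU p).trans_le (min_le_left _ _)) _ hθ h

end Assembly

end Summit.QuantumFields.YangMills.Theorems.PosOnSmallReduction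

end
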